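import Mathlib

/-!
# Monomial count — stub `stub_finrank_restrictTotalDegree` of line `SketchIdeator1`
(crux `GLnSeparatingDesigns.SeparationDegreeCost`, stmt-MatrixMultiplication-18361)

`dim_ℂ ℂ[x_σ]_{≤ s} = C(s + |σ|, |σ|)`: the polynomials of total degree `≤ s` in the `|σ|`
variables `σ` (Mathlib `MvPolynomial.restrictTotalDegree σ ℂ s`, with monomial basis
`MvPolynomial.basisRestrictSupport` indexed by the exponent vectors `n : σ →₀ ℕ` with `Σ n ≤ s`)
have dimension `C(s + |σ|, |σ|)`. The count is stars and bars with one slack variable: the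
exponents `n` with `Σ n ≤ s` are in bijection (`n ↦ n` extended by `s - Σ n` at `none`,
`Finsupp.optionElim`; inverse `Finsupp.some`) with the exponents `m : Option σ →₀ ℕ` with
`Σ m = s` (`Finset.finsuppAntidiag univ s`), which Mathlib counts as
`C(|σ| + 1 + s - 1, s) = C(s + |σ|, s) = C(s + |σ|, |σ|)`
(`Finset.card_finsuppAntidiag_nat_eq_choose`, `Nat.choose_symm_add`).
The lead uses it with `σ = Fin n × Fin n` (`|σ| = n²`): "the polynomials of degree `≤ s` in the
entries have dimension `C(s + n², n²)`" (Blasiak–Cohn–Grochow–Pratt–Umans 2024, Cor. 2.8, p. 15).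
-/

-- `Summit.MatrixMultiplication.MatrixMultiplication.…` is the tree's mandated summit-side namespace (Sub = Summit), flagged by `dupNamespace`.
set_option linter.dupNamespace false

namespace Summit.MatrixMultiplication.MatrixMultiplication.Theorems

/-- **Stars and bars with a slack variable**: the exponent vectors `n : σ →₀ ℕ` of total degree
`Σ n ≤ s` number `C(s + |σ|, |σ|)`. Bijection with `{m : Option σ →₀ ℕ | Σ m = s}`
(`n ↦ Finsupp.optionElim (s - Σ n) n`, inverse `Finsupp.some`), counted by
`Finset.card_finsuppAntidiag_nat_eq_choose`. [folklore] -/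
theorem nat_card_setOf_sum_le_eq_choose (σ : Type*) [Fintype σ] (s : ℕ) :
    Nat.card {n : σ →₀ ℕ | (n.sum fun _ e => e) ≤ s} =
      (s + Fintype.card σ).choose (Fintype.card σ) := by
  classical
  -- `Σ m = m none + Σ (m ∘ some)` for `m : Option σ →₀ ℕ`
  have hsum : ∀ m : Option σ →₀ ℕ, (m.sum fun _ e => e) = m none + (m.some.sum fun _ e => e) :=
    fun m => Finsupp.sum_option_index m (fun _ e => e) (fun _ => rfl) (fun _ _ _ => rfl)
  have hmem : ∀ m : Option σ →₀ ℕ,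
      m ∈ (Finset.univ : Finset (Option σ)).finsuppAntidiag s ↔ (m.sum fun _ e => e) = s := by
    intro m
    rw [Finset.mem_finsuppAntidiag']
    exact ⟨fun h => h.1, fun h => ⟨h, Finset.subset_univ _⟩⟩
  -- the slack-variable bijection
  let e : {n : σ →₀ ℕ | (n.sum fun _ e => e) ≤ s} ≃
      ↥((Finset.univ : Finset (Option σ)).finsuppAntidiag s) :=
    { toFun := fun n => ⟨n.1.optionElim (s - n.1.sum fun _ e => e), by
        have hn : (n.1.sum fun _ e => e) ≤ s := n.2
        rw [hmem, hsum, Finsupp.optionElim_apply_none, Finsupp.some_optionElim]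
        omega⟩
      invFun := fun m => ⟨m.1.some, by
        have h := (hmem m.1).1 m.2
        rw [hsum] at h
        show (m.1.some.sum fun _ e => e) ≤ s
        omega⟩
      left_inv := fun n => Subtype.ext (by simp only [Finsupp.some_optionElim])
      right_inv := fun m => Subtype.ext (by
        have h := (hmem m.1).1 m.2
        rw [hsum] at h
        have h' : s - (m.1.some.sum fun _ e => e) = m.1 none := by omega
        simp only [h', Finsupp.optionElim_some]) }
  rw [Nat.card_congr e, Nat.card_eq_fintype_card, Fintype.card_coe,
    Finset.card_finsuppAntidiag_nat_eq_choose, Finset.card_univ, Fintype.card_option,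
    show Fintype.card σ + 1 + s - 1 = s + Fintype.card σ by omega, Nat.choose_symm_add]

/-- **Stub S4 (monomial count).** `dim_ℂ ℂ[x_σ]_{≤ s} = C(s + |σ|, |σ|)`: the space
`MvPolynomial.restrictTotalDegree σ ℂ s` of polynomials of total degree `≤ s` in `|σ|` variables
has the monomial basis `MvPolynomial.basisRestrictSupport ℂ {n | Σ n ≤ s}`
(`Module.finrank_eq_nat_card_basis`), and the exponents are counted by stars and bars
(`nat_card_setOf_sum_le_eq_choose`). With `σ = Fin n × Fin n` this is the dimension
`C(s + n², n²)` of the host module of Blasiak–Cohn–Grochow–Pratt–Umans 2024, Cor. 2.8. [folklore] -/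
theorem stub_finrank_restrictTotalDegree (σ : Type*) [Fintype σ] (s : ℕ) :
    Module.finrank ℂ (MvPolynomial.restrictTotalDegree σ ℂ s) =
      (s + Fintype.card σ).choose (Fintype.card σ) :=
  (Module.finrank_eq_nat_card_basis
    (MvPolynomial.basisRestrictSupport ℂ {n : σ →₀ ℕ | (n.sum fun _ e => e) ≤ s})).trans
    (nat_card_setOf_sum_le_eq_choose σ s)

end Summit.MatrixMultiplication.MatrixMultiplication.Theorems
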